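/- Width seat `ym-line-sfw-p2-w5` (prover-ym-line-sfw-p2-w5-g18-0), free hands for planner ym-idea-2's STUB-PLAN-E (LINE-17 on crux
`AllWindowsColdBox.BoxMidWindowsSU22` = stmt-QuantumFields-24003, stub E `stub_tiltMoments`), piece E(1): the cubic part of the tilt as a
TRACE-FREE cubic form in the Gaussian coordinates. -/
import Summits.QuantumFields.YangMills.Theorems.AllWindowsColdBoxPlaqCostCubicTaylor
import Summits.QuantumFields.YangMills.Theorems.WeakCouplingRatesColdBoxDirichletLargeField

/-!
# The cubic part of the tilt is `β^{-1/2}` times a trace-free cubic form in the Gaussian coordinates (STUB-PLAN-E, piece E(1))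

Objects of `ColdBoxAllGroupsOneScaleDefs` / `AllWindowsColdBoxPlaqCostCubicTaylor`: colour tuples `t : TSpaceD H D = Fin D → ℝ^{DirFree H}`
(`D = dimE ρ`), the Gaussian reference `gaussD H D = boxDirichlet^{⊗D}`, the cubic part of the tilt `tiltCubicW ρ H β t` (sum over the
plaquettes `q` touching the cold box of `β·½Σ_{k<l}σₖσₗ·T_ρ(s_q, a_k, a_l)`, `a = extZero (unscaleTE H D β t) = t/√β` glued, `T_ρ = chartCubic ρ`).

With the LEGS `κ = Fin D × DirFree H` and the coordinate process `X_{(α,x)}(t) = t α x` (a centred Gaussian process under `gaussD`, colours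
independent, covariance `δ_{αβ}·(Q_D⁻¹)_{xy}` — sibling brick of seat w2), this file proves the DETERMINISTIC algebra of STUB-PLAN-E §2 E(1):

* `legInd`, `legPair`, `legTensor` — the edge 3-tensor `A_{xyz} = Σ_{q touching} λ_q(x)·½Σ_{k<l}σₖσₗ·[leg_k(q) = y]·[leg_l(q) = z]`
  (`λ_q = LatticeMaxwell.coeff …` the circulation coefficient vector of `dirCirc_eq_sum`; pinned legs never match a free index);
* `tiltCubicTensor ρ H a b c = T_ρ(e_{a₁}, e_{b₁}, e_{c₁}) · A_{a₂b₂c₂}` — the cubic tensor `B = τ ⊗ A` on the legs;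
* **`tiltCubicW_eq_inv_sqrt_mul_cubicForm`**: for `β > 0`,
  `tiltCubicW ρ H β t = (√β)⁻¹ · Σ_{a,b,c ∈ κ} tiltCubicTensor ρ H a b c · (X_a X_b X_c)` — the shape `Σ B a b c · (X_a X_b X_c)` of the tree's
  third-chaos theorems `CubicChaos.integral_cubicForm_sq(_le)` (✓ `AllWindowsColdBoxCubicChaosSecondMoment/VarianceBound`);
* **`tiltCubicTensor_mul_eq_zero₁₂/₁₃/₂₃`** and the three PARTIAL-TRACE CONDITIONS `sum_sum_tiltCubicTensor_mul_eq_zero₁₂/₁₃/₂₃` against ANY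
  colour-block-diagonal kernel `C` (`a₁ ≠ b₁ → C a b = 0`), in exactly the form of the hypotheses `hB12/hB13/hB23` of `integral_cubicForm_sq_le`:
  they hold term by term because the colour tensor `τ_{αβγ} = T_ρ(e_α,e_β,e_γ)` is ALTERNATING (`chartCubic_self₁₂/₁₃/₂₃`);
* `abs_chartCubic_single_le` (`|τ_{αβγ}| ≤ 2`), `chartCubic_eq_sum_prod` (trilinear expansion of `T_ρ(U,V,W)` for vectors whose colour components are
  linear forms in the coordinates — the bookkeeping lemma behind the main identity).

So `Var_{gaussD}(tiltCubicW) = β⁻¹·E[(Σ B·XXX)²] ≤ 6β⁻¹·‖B‖²_{Γ⊗Γ⊗Γ}` by the third-chaos contraction; the Gram/`K ⪯ I` evaluation of `‖B‖²`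
(E(3)) is the next brick.  Everything proved; four definitions (`legInd`, `legPair`, `legTensor`, `tiltCubicTensor`); standard axioms.
HONEST LABEL: helper toward the open registered stub E of a critic-passed line on the R2ξ″ RECORD-rung crux 24003; no stub is proved by name,
no crux, rung or summit is proved; the Yang–Mills mass gap is NOT proved by this file.
-/

set_option autoImplicit false

noncomputable section

open MeasureTheory Finset
open Literature.Probability.LatticeModels (Site)
open Literature.MathematicalPhysics.QuantumLattice
open Literature.MathematicalPhysics.QuantumFieldTheory
open Literature.MathematicalPhysics.QuantumFieldTheory.LatticeMaxwell
open Literature.MathematicalPhysics.QuantumFieldTheory.AxialGauge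
open Summit.QuantumFields.YangMills.Theorems.WeakCouplingRates
open Summit.QuantumFields.YangMills.Theorems.FreeEnergyLogCoefficient

namespace Summit.QuantumFields.YangMills.Theorems.ColdBoxAllGroups

variable {N : ℕ} {G : Type*} [Group G] (ρ : G →* Matrix (Fin N) (Fin N) ℂ) {H : ℕ}

/-! ## §1 The trilinear expansion of `T_ρ` on vectors with linear colour components -/

/-- The colour coefficient tensor is bounded by `2`: `|T_ρ(e_α,e_β,e_γ)| ≤ 2`. -/
theorem abs_chartCubic_single_le (α β γ : Fin (dimE ρ)) :
    |chartCubic ρ (EuclideanSpace.single α 1) (EuclideanSpace.single β 1) (EuclideanSpace.single γ 1)| ≤ 2 := by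
  have h := abs_chartCubic_le ρ (EuclideanSpace.single α (1 : ℝ)) (EuclideanSpace.single β 1) (EuclideanSpace.single γ 1)
  simp only [PiLp.norm_single, norm_one, mul_one] at h
  exact h

/-- **Trilinear expansion on the legs.**  If the colour components of `U, V, W ∈ ℝ^D` are linear forms `U_α = Σ_x u_x t_{αx}`, `V_α = Σ_x v_x t_{αx}`,
`W_α = Σ_x w_x t_{αx}` in a family `t : Fin D → ι → ℝ`, then
`T_ρ(U,V,W) = Σ_{a,b,c ∈ Fin D × ι} (τ_{a₁b₁c₁}·u_{a₂}v_{b₂}w_{c₂}) · (t_{a} t_{b} t_{c})`. -/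
theorem chartCubic_eq_sum_prod {ι : Type*} [Fintype ι] (t : Fin (dimE ρ) → ι → ℝ) (u v w : ι → ℝ)
    (U V W : EuclideanSpace ℝ (Fin (dimE ρ))) (hU : ∀ α, U α = ∑ x, u x * t α x) (hV : ∀ α, V α = ∑ x, v x * t α x)
    (hW : ∀ α, W α = ∑ x, w x * t α x) :
    chartCubic ρ U V W = ∑ a : Fin (dimE ρ) × ι, ∑ b : Fin (dimE ρ) × ι, ∑ c : Fin (dimE ρ) × ι,
      (chartCubic ρ (EuclideanSpace.single a.1 1) (EuclideanSpace.single b.1 1) (EuclideanSpace.single c.1 1) *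
        (u a.2 * v b.2 * w c.2)) * (t a.1 a.2 * t b.1 b.2 * t c.1 c.2) := by
  rw [chartCubic_eq_sum_coord]
  have hnest : (∑ α, ∑ β, ∑ γ, U α * V β * W γ *
      chartCubic ρ (EuclideanSpace.single α 1) (EuclideanSpace.single β 1) (EuclideanSpace.single γ 1)) =
      ∑ α, U α * ∑ β, V β * ∑ γ, W γ *
        chartCubic ρ (EuclideanSpace.single α 1) (EuclideanSpace.single β 1) (EuclideanSpace.single γ 1) := by
    simp only [Finset.mul_sum]
    refine Finset.sum_congr rfl fun α _ => Finset.sum_congr rfl fun β _ => Finset.sum_congr rfl fun γ _ => ?_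
    ring
  rw [hnest]
  simp only [Fintype.sum_prod_type]
  refine Finset.sum_congr rfl fun α _ => ?_
  rw [hU α, Finset.sum_mul]
  refine Finset.sum_congr rfl fun x _ => ?_
  rw [Finset.mul_sum]
  refine Finset.sum_congr rfl fun β _ => ?_
  rw [hV β, Finset.sum_mul, Finset.mul_sum]
  refine Finset.sum_congr rfl fun y _ => ?_
  rw [Finset.mul_sum, Finset.mul_sum]
  refine Finset.sum_congr rfl fun γ _ => ?_
  rw [hW γ, Finset.sum_mul, Finset.mul_sum, Finset.mul_sum]
  refine Finset.sum_congr rfl fun z _ => ?_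
  ring

/-! ## §2 The leg tensors -/

/-- The indicator that the free Dirichlet index `y` IS the edge `e` of `ℤ⁴` (as a real number). -/
def legInd (y : DirFree H) (e : Literature.MathematicalPhysics.QuantumLattice.ZdEdge 4) : ℝ :=
  if (y.1.1 : Literature.MathematicalPhysics.QuantumLattice.ZdEdge 4) = e then 1 else 0

/-- The glued Dirichlet edge function as a sum over the free indices: `dirGlue H s e = Σ_y s_y·[y = e]` (the tree's `glue_zero_eq_sum`). -/
theorem dirGlue_eq_sum_legInd (s : DirFree H → ℝ) (e : Literature.MathematicalPhysics.QuantumLattice.ZdEdge 4) :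
    dirGlue H s e = ∑ y : DirFree H, legInd y e * s y := by
  rw [dirGlue, glue_zero_eq_sum]
  exact Finset.sum_congr rfl fun y _ => by rw [legInd, mul_comm]

/-- **The signed leg-pair weight** of the plaquette `q = (x; i, j)` with legs `e₁ = (x,i)`, `e₂ = (x+eᵢ,j)`, `e₃ = (x+eⱼ,i)`, `e₄ = (x,j)` and signs
`σ = (+,+,−,−)`: `legPair q y z = ½Σ_{k<l} σₖσₗ·[y = e_k]·[z = e_l]`. -/
def legPair (q : Plaq 4) (y z : DirFree H) : ℝ :=
  (legInd y (q.1, q.2.1) * legInd z (q.1 + Pi.single q.2.1 1, q.2.2) -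
      legInd y (q.1, q.2.1) * legInd z (q.1 + Pi.single q.2.2 1, q.2.1) -
      legInd y (q.1, q.2.1) * legInd z (q.1, q.2.2) -
      legInd y (q.1 + Pi.single q.2.1 1, q.2.2) * legInd z (q.1 + Pi.single q.2.2 1, q.2.1) -
      legInd y (q.1 + Pi.single q.2.1 1, q.2.2) * legInd z (q.1, q.2.2) +
      legInd y (q.1 + Pi.single q.2.2 1, q.2.1) * legInd z (q.1, q.2.2)) / 2

variable (H) in
/-- **The edge 3-tensor of the cubic part of the tilt**: `A_{xyz} = Σ_{q touching Λ} λ_q(x)·legPair q y z`, `λ_q` the circulation coefficient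
vector of the plaquette `q` on the free Dirichlet indices (`dirCirc_eq_sum`). -/
def legTensor (x y z : DirFree H) : ℝ :=
  ∑ q ∈ plaquettesTouching (boxEdges 4 (2 * H + 1)),
    coeff (fun e => e ∉ dirFreeEdges H) dirCorner (2 * H + 3) ((q.1, q.2.1.1, q.2.1.2) : Plaq 4) x *
      legPair (q.1, q.2.1.1, q.2.1.2) y z

variable (H) in
/-- **The cubic tensor of the tilt on the legs `κ = Fin D × DirFree H`**: `B_{abc} = T_ρ(e_{a₁},e_{b₁},e_{c₁}) · A_{a₂b₂c₂}` (colour part = the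
alternating coefficient tensor of `chartCubic ρ`, edge part = `legTensor`). -/
def tiltCubicTensor (a b c : Fin (dimE ρ) × DirFree H) : ℝ :=
  chartCubic ρ (EuclideanSpace.single a.1 1) (EuclideanSpace.single b.1 1) (EuclideanSpace.single c.1 1) * legTensor H a.2 b.2 c.2

/-! ## §3 The partial-trace conditions (term by term, from alternation of the colour tensor) -/

/-- Slots 1,2: against a colour-block-diagonal kernel every term `B_{abc}·C_{ab}` vanishes. -/
theorem tiltCubicTensor_mul_eq_zero₁₂ {C : Fin (dimE ρ) × DirFree H → Fin (dimE ρ) × DirFree H → ℝ}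
    (hC : ∀ a b, a.1 ≠ b.1 → C a b = 0) (a b c : Fin (dimE ρ) × DirFree H) : tiltCubicTensor ρ H a b c * C a b = 0 := by
  by_cases h : a.1 = b.1
  · rw [tiltCubicTensor, h, chartCubic_self₁₂]; ring
  · rw [hC a b h, mul_zero]

/-- Slots 1,3: against a colour-block-diagonal kernel every term `B_{abc}·C_{ac}` vanishes. -/
theorem tiltCubicTensor_mul_eq_zero₁₃ {C : Fin (dimE ρ) × DirFree H → Fin (dimE ρ) × DirFree H → ℝ}
    (hC : ∀ a b, a.1 ≠ b.1 → C a b = 0) (a b c : Fin (dimE ρ) × DirFree H) : tiltCubicTensor ρ H a b c * C a c = 0 := by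
  by_cases h : a.1 = c.1
  · rw [tiltCubicTensor, h, chartCubic_self₁₃]; ring
  · rw [hC a c h, mul_zero]

/-- Slots 2,3: against a colour-block-diagonal kernel every term `B_{abc}·C_{bc}` vanishes. -/
theorem tiltCubicTensor_mul_eq_zero₂₃ {C : Fin (dimE ρ) × DirFree H → Fin (dimE ρ) × DirFree H → ℝ}
    (hC : ∀ a b, a.1 ≠ b.1 → C a b = 0) (a b c : Fin (dimE ρ) × DirFree H) : tiltCubicTensor ρ H a b c * C b c = 0 := by
  by_cases h : b.1 = c.1
  · rw [tiltCubicTensor, h, chartCubic_self₂₃]; ring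
  · rw [hC b c h, mul_zero]

/-- **Partial-trace condition (1,2)** (hypothesis `hB12` of `CubicChaos.integral_cubicForm_sq_le`): `Σ_{a,b} B_{abc} C_{ab} = 0` for every `c`. -/
theorem sum_sum_tiltCubicTensor_mul_eq_zero₁₂ {C : Fin (dimE ρ) × DirFree H → Fin (dimE ρ) × DirFree H → ℝ}
    (hC : ∀ a b, a.1 ≠ b.1 → C a b = 0) (c : Fin (dimE ρ) × DirFree H) :
    (∑ a, ∑ b, tiltCubicTensor ρ H a b c * C a b) = 0 :=
  Finset.sum_eq_zero fun a _ => Finset.sum_eq_zero fun b _ => tiltCubicTensor_mul_eq_zero₁₂ ρ hC a b c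

/-- **Partial-trace condition (1,3)** (hypothesis `hB13`): `Σ_{a,c} B_{abc} C_{ac} = 0` for every `b`. -/
theorem sum_sum_tiltCubicTensor_mul_eq_zero₁₃ {C : Fin (dimE ρ) × DirFree H → Fin (dimE ρ) × DirFree H → ℝ}
    (hC : ∀ a b, a.1 ≠ b.1 → C a b = 0) (b : Fin (dimE ρ) × DirFree H) :
    (∑ a, ∑ c, tiltCubicTensor ρ H a b c * C a c) = 0 :=
  Finset.sum_eq_zero fun a _ => Finset.sum_eq_zero fun c _ => tiltCubicTensor_mul_eq_zero₁₃ ρ hC a b c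

/-- **Partial-trace condition (2,3)** (hypothesis `hB23`): `Σ_{b,c} B_{abc} C_{bc} = 0` for every `a`. -/
theorem sum_sum_tiltCubicTensor_mul_eq_zero₂₃ {C : Fin (dimE ρ) × DirFree H → Fin (dimE ρ) × DirFree H → ℝ}
    (hC : ∀ a b, a.1 ≠ b.1 → C a b = 0) (a : Fin (dimE ρ) × DirFree H) :
    (∑ b, ∑ c, tiltCubicTensor ρ H a b c * C b c) = 0 :=
  Finset.sum_eq_zero fun b _ => Finset.sum_eq_zero fun c _ => tiltCubicTensor_mul_eq_zero₂₃ ρ hC a b c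

/-! ## §4 The cubic part of the tilt as a cubic form in the coordinates -/

/-- The colour components of the linear circulation of the chart coordinates: `(circV a q)_α = dirCirc H q (t α) / √β`. -/
theorem circV_extZero_unscaleTE_apply (β : ℝ) (t : TSpaceD H (dimE ρ)) (q : Plaq 4) (α : Fin (dimE ρ)) :
    circV (extZero (unscaleTE H (dimE ρ) β t)) q α = dirCirc H q (t α) / Real.sqrt β := by
  simp only [circV, PiLp.sub_apply, PiLp.add_apply, extZero_unscaleTE_apply, dirCirc_apply, sCirc]
  ring

/-- The circulation components are linear forms in the coordinates with weights `λ_q/√β`. -/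
theorem circV_extZero_unscaleTE_eq_sum (β : ℝ) (t : TSpaceD H (dimE ρ)) (q : Plaq 4) (α : Fin (dimE ρ)) :
    circV (extZero (unscaleTE H (dimE ρ) β t)) q α =
      ∑ x : DirFree H, ((Real.sqrt β)⁻¹ * coeff (fun e => e ∉ dirFreeEdges H) dirCorner (2 * H + 3) q x) * t α x := by
  rw [circV_extZero_unscaleTE_apply, dirCirc_eq_sum, div_eq_inv_mul, Finset.mul_sum]
  exact Finset.sum_congr rfl fun x _ => by ring

/-- The link components are linear forms in the coordinates with weights `[y = e]/√β`. -/
theorem extZero_unscaleTE_eq_sum (β : ℝ) (t : TSpaceD H (dimE ρ)) (e : Literature.MathematicalPhysics.QuantumLattice.ZdEdge 4)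
    (α : Fin (dimE ρ)) :
    extZero (unscaleTE H (dimE ρ) β t) e α = ∑ y : DirFree H, ((Real.sqrt β)⁻¹ * legInd y e) * t α y := by
  rw [extZero_unscaleTE_apply, dirGlue_eq_sum_legInd, div_eq_inv_mul, Finset.mul_sum]
  exact Finset.sum_congr rfl fun y _ => by ring

/-- One cubic term of a plaquette in the coordinates: `T_ρ(s, a_e, a_{e'}) = (√β)⁻³ · Σ_{abc} τ_{a₁b₁c₁}λ_q(a₂)[b₂ = e][c₂ = e'] · t_a t_b t_c`. -/
theorem chartCubic_circV_extZero_eq (β : ℝ) (t : TSpaceD H (dimE ρ)) (q : Plaq 4)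
    (e e' : Literature.MathematicalPhysics.QuantumLattice.ZdEdge 4) :
    chartCubic ρ (circV (extZero (unscaleTE H (dimE ρ) β t)) q) (extZero (unscaleTE H (dimE ρ) β t) e)
        (extZero (unscaleTE H (dimE ρ) β t) e') =
      (Real.sqrt β)⁻¹ ^ 3 * ∑ a : Fin (dimE ρ) × DirFree H, ∑ b : Fin (dimE ρ) × DirFree H, ∑ c : Fin (dimE ρ) × DirFree H,
        (chartCubic ρ (EuclideanSpace.single a.1 1) (EuclideanSpace.single b.1 1) (EuclideanSpace.single c.1 1) *
          (coeff (fun e => e ∉ dirFreeEdges H) dirCorner (2 * H + 3) q a.2 * (legInd b.2 e * legInd c.2 e'))) *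
          (t a.1 a.2 * t b.1 b.2 * t c.1 c.2) := by
  rw [chartCubic_eq_sum_prod ρ (fun α x => t α x) _ _ _ _ _ _ (circV_extZero_unscaleTE_eq_sum ρ β t q)
    (extZero_unscaleTE_eq_sum ρ β t e) (extZero_unscaleTE_eq_sum ρ β t e')]
  simp only [Finset.mul_sum]
  refine Finset.sum_congr rfl fun a _ => Finset.sum_congr rfl fun b _ => Finset.sum_congr rfl fun c _ => ?_
  ring

/-- **The cubic term of one plaquette** `q` touching the cold box (the summand of `tiltCubicW`, legs written as in `plaquetteEdges`) is
`β·(√β)⁻³ · Σ_{abc} τ_{a₁b₁c₁}·λ_q(a₂)·legPair q b₂ c₂ · t_a t_b t_c`. -/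
theorem plaquette_cubic_eq_sum (β : ℝ) (t : TSpaceD H (dimE ρ)) (q : ZdPlaquette 4) :
    β * ((chartCubic ρ (circV (extZero (unscaleTE H (dimE ρ) β t)) (q.1, q.2.1.1, q.2.1.2))
            (extZero (unscaleTE H (dimE ρ) β t) (q.1, q.2.1.1))
            (extZero (unscaleTE H (dimE ρ) β t) (q.1 + Pi.single q.2.1.1 1, q.2.1.2)) -
          chartCubic ρ (circV (extZero (unscaleTE H (dimE ρ) β t)) (q.1, q.2.1.1, q.2.1.2))
            (extZero (unscaleTE H (dimE ρ) β t) (q.1, q.2.1.1))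
            (extZero (unscaleTE H (dimE ρ) β t) (q.1 + Pi.single q.2.1.2 1, q.2.1.1)) -
          chartCubic ρ (circV (extZero (unscaleTE H (dimE ρ) β t)) (q.1, q.2.1.1, q.2.1.2))
            (extZero (unscaleTE H (dimE ρ) β t) (q.1, q.2.1.1)) (extZero (unscaleTE H (dimE ρ) β t) (q.1, q.2.1.2)) -
          chartCubic ρ (circV (extZero (unscaleTE H (dimE ρ) β t)) (q.1, q.2.1.1, q.2.1.2))
            (extZero (unscaleTE H (dimE ρ) β t) (q.1 + Pi.single q.2.1.1 1, q.2.1.2))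
            (extZero (unscaleTE H (dimE ρ) β t) (q.1 + Pi.single q.2.1.2 1, q.2.1.1)) -
          chartCubic ρ (circV (extZero (unscaleTE H (dimE ρ) β t)) (q.1, q.2.1.1, q.2.1.2))
            (extZero (unscaleTE H (dimE ρ) β t) (q.1 + Pi.single q.2.1.1 1, q.2.1.2))
            (extZero (unscaleTE H (dimE ρ) β t) (q.1, q.2.1.2)) +
          chartCubic ρ (circV (extZero (unscaleTE H (dimE ρ) β t)) (q.1, q.2.1.1, q.2.1.2))
            (extZero (unscaleTE H (dimE ρ) β t) (q.1 + Pi.single q.2.1.2 1, q.2.1.1))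
            (extZero (unscaleTE H (dimE ρ) β t) (q.1, q.2.1.2))) / 2) =
      β * (Real.sqrt β)⁻¹ ^ 3 * ∑ a : Fin (dimE ρ) × DirFree H, ∑ b : Fin (dimE ρ) × DirFree H, ∑ c : Fin (dimE ρ) × DirFree H,
        (chartCubic ρ (EuclideanSpace.single a.1 1) (EuclideanSpace.single b.1 1) (EuclideanSpace.single c.1 1) *
          (coeff (fun e => e ∉ dirFreeEdges H) dirCorner (2 * H + 3) ((q.1, q.2.1.1, q.2.1.2) : Plaq 4) a.2 *
            legPair ((q.1, q.2.1.1, q.2.1.2) : Plaq 4) b.2 c.2)) *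
          (t a.1 a.2 * t b.1 b.2 * t c.1 c.2) := by
  simp only [chartCubic_circV_extZero_eq]
  -- expand `legPair` on the right and split the sums
  have hsplit : ∀ a b c : Fin (dimE ρ) × DirFree H,
      (chartCubic ρ (EuclideanSpace.single a.1 1) (EuclideanSpace.single b.1 1) (EuclideanSpace.single c.1 1) *
          (coeff (fun e => e ∉ dirFreeEdges H) dirCorner (2 * H + 3) ((q.1, q.2.1.1, q.2.1.2) : Plaq 4) a.2 *
            legPair ((q.1, q.2.1.1, q.2.1.2) : Plaq 4) b.2 c.2)) *
          (t a.1 a.2 * t b.1 b.2 * t c.1 c.2) =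
        ((chartCubic ρ (EuclideanSpace.single a.1 1) (EuclideanSpace.single b.1 1) (EuclideanSpace.single c.1 1) *
            (coeff (fun e => e ∉ dirFreeEdges H) dirCorner (2 * H + 3) ((q.1, q.2.1.1, q.2.1.2) : Plaq 4) a.2 *
              (legInd b.2 (q.1, q.2.1.1) * legInd c.2 (q.1 + Pi.single q.2.1.1 1, q.2.1.2)))) *
            (t a.1 a.2 * t b.1 b.2 * t c.1 c.2) -
          (chartCubic ρ (EuclideanSpace.single a.1 1) (EuclideanSpace.single b.1 1) (EuclideanSpace.single c.1 1) *
            (coeff (fun e => e ∉ dirFreeEdges H) dirCorner (2 * H + 3) ((q.1, q.2.1.1, q.2.1.2) : Plaq 4) a.2 *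
              (legInd b.2 (q.1, q.2.1.1) * legInd c.2 (q.1 + Pi.single q.2.1.2 1, q.2.1.1)))) *
            (t a.1 a.2 * t b.1 b.2 * t c.1 c.2) -
          (chartCubic ρ (EuclideanSpace.single a.1 1) (EuclideanSpace.single b.1 1) (EuclideanSpace.single c.1 1) *
            (coeff (fun e => e ∉ dirFreeEdges H) dirCorner (2 * H + 3) ((q.1, q.2.1.1, q.2.1.2) : Plaq 4) a.2 *
              (legInd b.2 (q.1, q.2.1.1) * legInd c.2 (q.1, q.2.1.2)))) *
            (t a.1 a.2 * t b.1 b.2 * t c.1 c.2) -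
          (chartCubic ρ (EuclideanSpace.single a.1 1) (EuclideanSpace.single b.1 1) (EuclideanSpace.single c.1 1) *
            (coeff (fun e => e ∉ dirFreeEdges H) dirCorner (2 * H + 3) ((q.1, q.2.1.1, q.2.1.2) : Plaq 4) a.2 *
              (legInd b.2 (q.1 + Pi.single q.2.1.1 1, q.2.1.2) * legInd c.2 (q.1 + Pi.single q.2.1.2 1, q.2.1.1)))) *
            (t a.1 a.2 * t b.1 b.2 * t c.1 c.2) -
          (chartCubic ρ (EuclideanSpace.single a.1 1) (EuclideanSpace.single b.1 1) (EuclideanSpace.single c.1 1) *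
            (coeff (fun e => e ∉ dirFreeEdges H) dirCorner (2 * H + 3) ((q.1, q.2.1.1, q.2.1.2) : Plaq 4) a.2 *
              (legInd b.2 (q.1 + Pi.single q.2.1.1 1, q.2.1.2) * legInd c.2 (q.1, q.2.1.2)))) *
            (t a.1 a.2 * t b.1 b.2 * t c.1 c.2) +
          (chartCubic ρ (EuclideanSpace.single a.1 1) (EuclideanSpace.single b.1 1) (EuclideanSpace.single c.1 1) *
            (coeff (fun e => e ∉ dirFreeEdges H) dirCorner (2 * H + 3) ((q.1, q.2.1.1, q.2.1.2) : Plaq 4) a.2 *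
              (legInd b.2 (q.1 + Pi.single q.2.1.2 1, q.2.1.1) * legInd c.2 (q.1, q.2.1.2)))) *
            (t a.1 a.2 * t b.1 b.2 * t c.1 c.2)) / 2 := by
    intro a b c
    simp only [legPair]
    ring
  simp only [hsplit, ← Finset.sum_div, Finset.sum_add_distrib, Finset.sum_sub_distrib]
  ring

/-- **E(1): the cubic part of the tilt is `(√β)⁻¹` times a cubic form in the Gaussian coordinates.**  For `β > 0` and every colour tuple `t`,
`tiltCubicW ρ H β t = (√β)⁻¹ · Σ_{a,b,c ∈ Fin D × DirFree H} tiltCubicTensor ρ H a b c · (t_{a₁a₂} · t_{b₁b₂} · t_{c₁c₂})`. -/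
theorem tiltCubicW_eq_inv_sqrt_mul_cubicForm {β : ℝ} (hβ : 0 < β) (t : TSpaceD H (dimE ρ)) :
    tiltCubicW ρ H β t = (Real.sqrt β)⁻¹ * ∑ a : Fin (dimE ρ) × DirFree H, ∑ b : Fin (dimE ρ) × DirFree H,
      ∑ c : Fin (dimE ρ) × DirFree H, tiltCubicTensor ρ H a b c * (t a.1 a.2 * t b.1 b.2 * t c.1 c.2) := by
  have hsq : Real.sqrt β ^ 2 = β := Real.sq_sqrt hβ.le
  have hc : β * (Real.sqrt β)⁻¹ ^ 3 = (Real.sqrt β)⁻¹ := by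
    rw [inv_pow, show Real.sqrt β ^ 3 = β * Real.sqrt β by rw [pow_succ, hsq], mul_inv, ← mul_assoc,
      mul_inv_cancel₀ hβ.ne', one_mul]
  rw [tiltCubicW, Finset.sum_congr rfl fun q _ => plaquette_cubic_eq_sum ρ β t q, ← Finset.mul_sum, hc]
  congr 1
  -- exchange the plaquette sum with the three leg sums and factor the colour tensor
  simp only [tiltCubicTensor, legTensor, Finset.sum_mul, Finset.mul_sum]
  rw [Finset.sum_comm]
  refine Finset.sum_congr rfl fun a _ => ?_
  rw [Finset.sum_comm]
  refine Finset.sum_congr rfl fun b _ => ?_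
  rw [Finset.sum_comm]

end Summit.QuantumFields.YangMills.Theorems.ColdBoxAllGroups

end
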